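import Mathlib
import Summits.NavierStokesRegularity.NavierStokesRegularity.Theorems.ScenarioCensusPitchDefectColumnarPairing
import Literature.Analysis.FluidPDE.NSBoundedMildOseenDuhamel
import Literature.Analysis.FluidPDE.NSBoundedMildOseenClassical
import Literature.Analysis.FluidPDE.BoundedAnnihilator
import Literature.Analysis.FluidPDE.OseenBallAverageMomentum
import Literature.Analysis.FluidPDE.ForcedOseenMildPeriodic
import Literature.Analysis.UnboundedOperators.HeatExtensionDecay
import HarnessLib

/-!
# Census row A8t, line «pitch-defect»: columnar swirl–axial fields are Oseen-invisible (stub S3a2)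

Support file for the scenario census of `NavierStokesRegularity` (row A8t, line «pitch-defect»,
stub S3a2 `stub_columnarOseenInvisible`; KEY-NS #101 (2)), moving-axis form.

PROVED, `columnar_oseenDuhamel_ae_zero`: let `W` be a field on `(−∞,0) × ℝ³`, jointly continuous
on the open slab, whose slices are `C¹` with `‖W(τ)‖ ≤ C'/√(−τ)`, `‖∇W(τ)‖ ≤ C₁/(−τ)`,
divergence free, independent of `x₃` and rotation-equivariant about the vertical axis through
`−A(τ)` (the output of `exists_pitchAverage`). Then for all `s < t < 0` the Oseen bilinear term
vanishes: `B¹ₛ(W,W)(t) = 0` a.e. Proof: `N = B¹ₛ(W,W)(t)` is bounded, a.e.-strongly measurable and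
weakly divergence free (`isWeaklyDivFree_oseenDuhamel`); tested against a solenoidal test field `φ`
it is `−∫ₛᵗ∫⟪W(τ), D(e^{(t−τ)Δ}φ)[W(τ)]⟫` (`integral_inner_oseenDuhamel_of_isDivFree`), and each
slice integral vanishes by the slice identity `Columnar.integral_inner_fderiv_apply_eq_zero`
(after translating the axis to the origin; the caloric field `e^{(t−τ)Δ}φ` is `C¹`, divergence
free and decays to every polynomial order, `exists_pow_mul_norm_heatExtension_le`). So `N`
annihilates the solenoidal tests and is a.e. a constant (`L^∞` annihilator lemma,
`IsWeaklyDivFree.exists_ae_eq_const_of_norm_le_of_forall_integral_inner_eq_zero`), and the constant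
is `0` because the ball averages of `N` vanish at infinity (`tendsto_setAverage_oseenDuhamel`).

No summit statement and no census row is proved here; nothing here is a claim about NS regularity.
-/

-- the summit and its single problem share the name (D-0017 nested layout)
set_option linter.dupNamespace false

noncomputable section

open MeasureTheory Set Function Filter Metric
open scoped Topology ENNReal NNReal RealInnerProductSpace

namespace Summit.NavierStokesRegularity.NavierStokesRegularity.Theorems.ScenarioCensus.PitchDefect

open Literature.Analysis Literature.Analysis.FluidPDE

/-- Polynomial weights: `(1 + r)⁵ ≤ 16 (1 + r⁵)` for `r ≥ 0`. [folklore] -/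
theorem one_add_pow_five_le {r : ℝ} (hr : 0 ≤ r) : (1 + r) ^ 5 ≤ 16 * (1 + r ^ 5) := by
  nlinarith [sq_nonneg (r - 1), sq_nonneg (r ^ 2 - 1), sq_nonneg (r ^ 2 - r), sq_nonneg r,
    mul_nonneg hr (sq_nonneg (r - 1)), mul_nonneg hr (sq_nonneg (r ^ 2 - 1)),
    mul_nonneg (mul_nonneg hr hr) (sq_nonneg (r - 1)), pow_nonneg hr 3, pow_nonneg hr 5]

/-- **The caloric extension of a test field, translated, has the fifth-order polynomial decay
used by the slice identity** (for the field and its derivative). [folklore] -/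
theorem caloric_decay_five {φ : EuclideanSpace ℝ (Fin 3) → EuclideanSpace ℝ (Fin 3)}
    (hφ : ContDiff ℝ 1 φ) (hc : HasCompactSupport φ) {a : ℝ} (ha : 0 < a)
    (b : EuclideanSpace ℝ (Fin 3)) :
    ∃ K : ℝ, (∀ y, (1 + ‖y‖) ^ 5 * ‖UnboundedOperators.heatExtension φ a (y + b)‖ ≤ K) ∧
      ∀ y, (1 + ‖y‖) ^ 5 *
        ‖fderiv ℝ (fun z => UnboundedOperators.heatExtension φ a (z + b)) y‖ ≤ K := by
  have hφc : Continuous φ := hφ.continuous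
  have hDφc : Continuous (fderiv ℝ φ) := hφ.continuous_fderiv one_ne_zero
  have hDc : HasCompactSupport (fderiv ℝ φ) := hc.fderiv ℝ
  obtain ⟨A₀, hA₀, h0⟩ := UnboundedOperators.exists_pow_mul_norm_heatExtension_le hφc hc ha 0
  obtain ⟨A₅, hA₅, h5⟩ := UnboundedOperators.exists_pow_mul_norm_heatExtension_le hφc hc ha 5
  obtain ⟨B₀, hB₀, g0⟩ := UnboundedOperators.exists_pow_mul_norm_heatExtension_le hDφc hDc ha 0
  obtain ⟨B₅, hB₅, g5⟩ := UnboundedOperators.exists_pow_mul_norm_heatExtension_le hDφc hDc ha 5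
  -- weights: `(1+‖y‖)^5 ≤ (1+‖b‖)^5 (1+‖y+b‖)^5 ≤ (1+‖b‖)^5 · 16 (1 + ‖y+b‖^5)`
  have hw : ∀ y : EuclideanSpace ℝ (Fin 3), (1 + ‖y‖) ^ 5 ≤ (1 + ‖b‖) ^ 5 * (16 * (1 + ‖y + b‖ ^ 5)) := by
    intro y
    have h1 : 1 + ‖y‖ ≤ (1 + ‖b‖) * (1 + ‖y + b‖) := by
      have : ‖y‖ ≤ ‖y + b‖ + ‖b‖ := by
        calc ‖y‖ = ‖(y + b) - b‖ := by rw [add_sub_cancel_right]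
          _ ≤ ‖y + b‖ + ‖b‖ := norm_sub_le _ _
      nlinarith [norm_nonneg b, norm_nonneg (y + b)]
    calc (1 + ‖y‖) ^ 5 ≤ ((1 + ‖b‖) * (1 + ‖y + b‖)) ^ 5 :=
          pow_le_pow_left₀ (by positivity) h1 5
      _ = (1 + ‖b‖) ^ 5 * (1 + ‖y + b‖) ^ 5 := by ring
      _ ≤ (1 + ‖b‖) ^ 5 * (16 * (1 + ‖y + b‖ ^ 5)) :=
          mul_le_mul_of_nonneg_left (one_add_pow_five_le (norm_nonneg _)) (by positivity)
  set K₀ : ℝ := (1 + ‖b‖) ^ 5 * (16 * (A₀ + A₅)) with hK₀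
  set K₁ : ℝ := (1 + ‖b‖) ^ 5 * (16 * (B₀ + B₅)) with hK₁
  refine ⟨max K₀ K₁, fun y => ?_, fun y => ?_⟩
  · have key : (1 + ‖y + b‖ ^ 5) * ‖UnboundedOperators.heatExtension φ a (y + b)‖ ≤ A₀ + A₅ := by
      have e0 := h0 (y + b); have e5 := h5 (y + b)
      rw [pow_zero, one_mul] at e0
      nlinarith
    calc (1 + ‖y‖) ^ 5 * ‖UnboundedOperators.heatExtension φ a (y + b)‖
        ≤ (1 + ‖b‖) ^ 5 * (16 * (1 + ‖y + b‖ ^ 5)) * ‖UnboundedOperators.heatExtension φ a (y + b)‖ :=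
          mul_le_mul_of_nonneg_right (hw y) (norm_nonneg _)
      _ = (1 + ‖b‖) ^ 5 * 16 * ((1 + ‖y + b‖ ^ 5) * ‖UnboundedOperators.heatExtension φ a (y + b)‖) := by ring
      _ ≤ (1 + ‖b‖) ^ 5 * 16 * (A₀ + A₅) := mul_le_mul_of_nonneg_left key (by positivity)
      _ = K₀ := by rw [hK₀]; ring
      _ ≤ max K₀ K₁ := le_max_left _ _
  · have hD : fderiv ℝ (fun z => UnboundedOperators.heatExtension φ a (z + b)) y =
        UnboundedOperators.heatExtension (fderiv ℝ φ) a (y + b) := by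
      rw [fderiv_comp_add_right, UnboundedOperators.fderiv_heatExtension_of_hasCompactSupport hφ hc]
    rw [hD]
    have key : (1 + ‖y + b‖ ^ 5) * ‖UnboundedOperators.heatExtension (fderiv ℝ φ) a (y + b)‖ ≤ B₀ + B₅ := by
      have e0 := g0 (y + b); have e5 := g5 (y + b)
      rw [pow_zero, one_mul] at e0
      nlinarith
    calc (1 + ‖y‖) ^ 5 * ‖UnboundedOperators.heatExtension (fderiv ℝ φ) a (y + b)‖
        ≤ (1 + ‖b‖) ^ 5 * (16 * (1 + ‖y + b‖ ^ 5)) *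
            ‖UnboundedOperators.heatExtension (fderiv ℝ φ) a (y + b)‖ :=
          mul_le_mul_of_nonneg_right (hw y) (norm_nonneg _)
      _ = (1 + ‖b‖) ^ 5 * 16 * ((1 + ‖y + b‖ ^ 5) *
            ‖UnboundedOperators.heatExtension (fderiv ℝ φ) a (y + b)‖) := by ring
      _ ≤ (1 + ‖b‖) ^ 5 * 16 * (B₀ + B₅) := mul_le_mul_of_nonneg_left key (by positivity)
      _ = K₁ := by rw [hK₁]; ring
      _ ≤ max K₀ K₁ := le_max_right _ _

/-- **Columnar swirl–axial fields are Oseen-invisible (stub S3a2 of «pitch-defect», moving-axis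
form).** See the module docstring. [cite: KochNadirashviliSereginSverak2009, §4 p. 8 (the bilinear form B; arXiv:0709.3599)] -/
theorem columnar_oseenDuhamel_ae_zero {C' C₁ : ℝ}
    {W : ℝ → EuclideanSpace ℝ (Fin 3) → EuclideanSpace ℝ (Fin 3)} {A : ℝ → EuclideanSpace ℝ (Fin 3)}
    (hWc : ContinuousOn (uncurry W) (Iio 0 ×ˢ univ))
    (hW1 : ∀ τ < 0, ContDiff ℝ 1 (W τ))
    (hWbd : ∀ τ < 0, ∀ y, ‖W τ y‖ ≤ C' / Real.sqrt (-τ))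
    (hWgrad : ∀ τ < 0, ∀ y, ‖fderiv ℝ (W τ) y‖ ≤ C₁ / (-τ))
    (hWdiv : ∀ τ < 0, VectorCalculus.IsDivFree (W τ))
    (hWz : ∀ τ < 0, ∀ (s : ℝ) (y : EuclideanSpace ℝ (Fin 3)),
      W τ (y + s • EuclideanSpace.single 2 (1 : ℝ)) = W τ y)
    (hWrot : ∀ τ < 0, ∀ (θ : ℝ) (y : EuclideanSpace ℝ (Fin 3)),
      W τ (rotZ θ (y + A τ) - A τ) = rotZ θ (W τ y)) :
    ∀ s t : ℝ, s < t → t < 0 →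
      ∀ᵐ y ∂(volume : Measure (EuclideanSpace ℝ (Fin 3))), oseenDuhamel 1 s W W t y = 0 := by
  intro s t hst ht
  have hd : Module.finrank ℝ (EuclideanSpace ℝ (Fin 3)) = 3 := finrank_euclideanSpace_fin
  -- bounds on the slab
  set M : ℝ := C' / Real.sqrt (-t) with hM
  have hC'0 : 0 ≤ C' := by
    have h := (norm_nonneg _).trans (hWbd t ht 0)
    rw [le_div_iff₀ (Real.sqrt_pos.2 (by linarith))] at h
    simpa using h
  have hM0 : 0 ≤ M := div_nonneg hC'0 (Real.sqrt_nonneg _)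
  have hWM : ∀ σ, σ ≤ t → ∀ y, ‖W σ y‖ ≤ M := fun σ hσ y =>
    (hWbd σ (lt_of_le_of_lt hσ ht) y).trans
      (div_le_div_of_nonneg_left hC'0 (Real.sqrt_pos.2 (by linarith)) (Real.sqrt_le_sqrt (by linarith)))
  have hb : ∀ σ ∈ Ioo s t, ∀ y, ‖W σ y‖ ≤ M := fun σ hσ y => hWM σ hσ.2.le y
  have hmeas : AEStronglyMeasurable (uncurry W)
      ((volume : Measure (ℝ × EuclideanSpace ℝ (Fin 3))).restrict (Ioo s t ×ˢ univ)) :=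
    (hWc.mono (prod_mono (fun σ hσ => lt_trans hσ.2 ht) Subset.rfl)).aestronglyMeasurable
      (measurableSet_Ioo.prod MeasurableSet.univ)
  set N : EuclideanSpace ℝ (Fin 3) → EuclideanSpace ℝ (Fin 3) := oseenDuhamel 1 s W W t with hN
  -- ## (1)-(3): `N` is weakly divergence free, measurable, bounded
  have hNdiv : IsWeaklyDivFree N := isWeaklyDivFree_oseenDuhamel one_pos hmeas hmeas hM0 hb hb hst le_rfl
  have hNm : AEStronglyMeasurable N volume :=
    aestronglyMeasurable_oseenDuhamel one_pos hmeas hmeas hM0 hb hb hst le_rfl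
  obtain ⟨C₀, -, hC₀⟩ := exists_norm_oseenDuhamel_bounded_le (E := EuclideanSpace ℝ (Fin 3))
  have hNb : ∀ x, ‖N x‖ ≤ C₀ * M ^ 2 * (1 : ℝ) ^ (-(1 / 2 : ℝ)) * (2 * Real.sqrt (t - s)) :=
    fun x => hC₀ one_pos hst hM0 hb hb x
  -- ## (4): `N` annihilates the solenoidal tests
  have horth : ∀ φ : EuclideanSpace ℝ (Fin 3) → EuclideanSpace ℝ (Fin 3),
      FunctionSpaces.IsTestFunctionOn (⊤ : TopologicalSpace.Opens (EuclideanSpace ℝ (Fin 3))) φ →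
      VectorCalculus.IsDivFree φ → ∫ x, ⟪N x, φ x⟫ = 0 := by
    intro φ hφ hφdiv
    rw [(integral_inner_oseenDuhamel_of_isDivFree one_pos hmeas hmeas hM0 hb hb hst le_rfl hφ hφdiv).2,
      neg_eq_zero]
    refine (setIntegral_congr_fun measurableSet_Ioo (g := fun _ => (0 : ℝ)) fun τ hτ => ?_).trans
      (by simp)
    -- the slice at time `τ`: translate the axis to the origin and apply the slice identity
    have hτ0 : τ < 0 := hτ.2.trans ht
    have ha : 0 < 1 * (t - τ) := by rw [one_mul]; exact sub_pos.2 hτ.2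
    have hφ1 : ContDiff ℝ 1 φ := hφ.contDiff.of_le (by exact_mod_cast le_top)
    set b : EuclideanSpace ℝ (Fin 3) := -A τ with hbdef
    set Z : EuclideanSpace ℝ (Fin 3) → EuclideanSpace ℝ (Fin 3) := fun y => W τ (y + b) with hZ
    set ψ : EuclideanSpace ℝ (Fin 3) → EuclideanSpace ℝ (Fin 3) :=
      fun y => UnboundedOperators.heatExtension φ (1 * (t - τ)) (y + b) with hψ
    -- columnar hypotheses for `Z`
    have hZ1 : ContDiff ℝ 1 Z := (hW1 τ hτ0).comp ((contDiff_id).add contDiff_const)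
    have hZM : ∀ y, ‖Z y‖ ≤ C' / Real.sqrt (-τ) := fun y => hWbd τ hτ0 _
    have hZfd : ∀ y, fderiv ℝ Z y = fderiv ℝ (W τ) (y + b) := fun y => by
      rw [hZ, fderiv_comp_add_right]
    have hZL : ∀ y, ‖fderiv ℝ Z y‖ ≤ C₁ / (-τ) := fun y => by rw [hZfd]; exact hWgrad τ hτ0 _
    have hZdiv : VectorCalculus.IsDivFree Z := fun y => by
      have h := hWdiv τ hτ0 (y + b)
      rw [VectorCalculus.divergence, hZfd]
      exact h
    have hZz : ∀ (σ : ℝ) (y : EuclideanSpace ℝ (Fin 3)), Z (y + σ • EuclideanSpace.single 2 (1 : ℝ)) = Z y := by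
      intro σ y
      simp only [hZ]
      rw [add_right_comm, hWz τ hτ0]
    have hZrot : ∀ (θ : ℝ) (y : EuclideanSpace ℝ (Fin 3)), Z (rotZ θ y) = rotZ θ (Z y) := by
      intro θ y
      simp only [hZ, hbdef]
      have key := hWrot τ hτ0 θ (y + -A τ)
      rw [neg_add_cancel_right] at key
      rw [← sub_eq_add_neg, key]
    -- hypotheses for `ψ`
    have hψ1 : ContDiff ℝ 1 ψ :=
      (UnboundedOperators.contDiff_heatExtension_of_hasCompactSupport hφ1 hφ.hasCompactSupport _).comp
        ((contDiff_id).add contDiff_const)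
    have hHdiv : VectorCalculus.IsDivFree (UnboundedOperators.heatExtension φ (1 * (t - τ))) := by
      obtain ⟨R, hR⟩ := (hφ.contDiff.continuous.norm).bddAbove_range_of_hasCompactSupport
        hφ.hasCompactSupport.norm
      have hbφ : ∀ x, ‖φ x‖ ≤ R := fun x => hR ⟨x, rfl⟩
      have hw : IsWeaklyDivFree (UnboundedOperators.heatExtension φ (1 * (t - τ))) :=
        (VectorCalculus.IsDivFree.isWeaklyDivFree_holds hφdiv hφ1).heatExtension_of_bound
          hφ.contDiff.continuous.aestronglyMeasurable hbφ ha
      exact hw.isDivFree_of_contDiff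
        (UnboundedOperators.contDiff_heatExtension_of_hasCompactSupport hφ1 hφ.hasCompactSupport _)
    have hψdiv : VectorCalculus.IsDivFree ψ := fun y => by
      have h := hHdiv (y + b)
      rw [VectorCalculus.divergence, hψ, fderiv_comp_add_right]
      exact h
    obtain ⟨K, hK1, hK2⟩ := caloric_decay_five hφ1 hφ.hasCompactSupport ha b
    -- the slice identity for `(Z, ψ)`, translated back
    have hslice := Columnar.integral_inner_fderiv_apply_eq_zero hZ1 hZM hZL hZdiv hZz hZrot hψ1 hψdiv hK1 hK2
    have htr : ∫ y, ⟪W τ y, fderiv ℝ (UnboundedOperators.heatExtension φ (1 * (t - τ))) y (W τ y)⟫ =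
        ∫ y, ⟪Z y, fderiv ℝ ψ y (Z y)⟫ := by
      rw [← integral_add_right_eq_self (μ := (volume : Measure (EuclideanSpace ℝ (Fin 3))))
        (fun y => ⟪W τ y, fderiv ℝ (UnboundedOperators.heatExtension φ (1 * (t - τ))) y (W τ y)⟫) b]
      refine integral_congr_ae (Eventually.of_forall fun y => ?_)
      simp only [hZ, hψ]
      rw [fderiv_comp_add_right]
    simp only
    rw [htr, hslice]
  -- ## (5): `N` is a.e. a constant
  obtain ⟨c, hc⟩ :=
    IsWeaklyDivFree.exists_ae_eq_const_of_norm_le_of_forall_integral_inner_eq_zero hNm hNb hNdiv horth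
  -- ## (6): ball averages of `N` vanish at infinity, through a measurable modification of `W`
  classical
  set W' : ℝ → EuclideanSpace ℝ (Fin 3) → EuclideanSpace ℝ (Fin 3) :=
    fun σ y => (Iio (0 : ℝ) ×ˢ (univ : Set (EuclideanSpace ℝ (Fin 3)))).piecewise (uncurry W) 0 (σ, y)
    with hW'
  have hW'm : Measurable (uncurry W') := by
    have e : uncurry W' = (Iio (0 : ℝ) ×ˢ (univ : Set (EuclideanSpace ℝ (Fin 3)))).piecewise (uncurry W) 0 := by
      funext p; rfl
    rw [e]
    exact hWc.measurable_piecewise continuousOn_const (measurableSet_Iio.prod MeasurableSet.univ)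
  have hW'eq : ∀ σ < 0, W' σ = W σ := by
    intro σ hσ
    funext y
    simp only [hW']
    rw [Set.piecewise_eq_of_mem _ _ _ (show (σ, y) ∈ Iio (0 : ℝ) ×ˢ (univ : Set (EuclideanSpace ℝ (Fin 3)))
      from ⟨hσ, mem_univ _⟩)]
    rfl
  have hW'b : ∀ σ ∈ Icc s t, ∀ y, ‖W' σ y‖ ≤ M := by
    intro σ hσ y
    rw [hW'eq σ (lt_of_le_of_lt hσ.2 ht)]
    exact hWM σ hσ.2 y
  have hlim := tendsto_setAverage_oseenDuhamel hd hW'm hst hW'b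
  have hNN' : oseenDuhamel 1 s W' W' t = N := by
    funext x
    rw [hN]
    exact oseenDuhamel_congr_of_eqOn_Ioo (fun τ hτ => hW'eq τ (hτ.2.trans ht))
      (fun τ hτ => hW'eq τ (hτ.2.trans ht)) x
  rw [hNN'] at hlim
  -- the averages are the constant `c`
  have havg : ∀ R : ℝ, 0 < R → ⨍ x in ball (0 : EuclideanSpace ℝ (Fin 3)) R, N x = c := by
    intro R hR
    have hμ0 : volume (ball (0 : EuclideanSpace ℝ (Fin 3)) R) ≠ 0 := (measure_ball_pos volume _ hR).ne'
    have hμ : volume (ball (0 : EuclideanSpace ℝ (Fin 3)) R) ≠ ∞ := measure_ball_lt_top.ne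
    have h1 : ⨍ x in ball (0 : EuclideanSpace ℝ (Fin 3)) R, N x =
        ⨍ x in ball (0 : EuclideanSpace ℝ (Fin 3)) R, (fun _ => c) x := by
      rw [setAverage_eq, setAverage_eq, integral_congr_ae (ae_restrict_of_ae hc)]
    rw [h1, setAverage_const hμ0 hμ]
  have hlim' : Tendsto (fun R : ℝ => ⨍ x in ball (0 : EuclideanSpace ℝ (Fin 3)) R, N x) atTop (𝓝 c) :=
    tendsto_const_nhds.congr' (by
      filter_upwards [eventually_gt_atTop 0] with R hR
      exact (havg R hR).symm)
  have hc0 : c = 0 := tendsto_nhds_unique hlim' hlim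
  filter_upwards [hc] with y hy
  rw [hy, hc0]

end Summit.NavierStokesRegularity.NavierStokesRegularity.Theorems.ScenarioCensus.PitchDefect

end
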